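import Summits.BirchSwinnertonDyer.BirchSwinnertonDyer.Theses.KatoDescentTamePotSupersingular
import Summits.BirchSwinnertonDyer.BirchSwinnertonDyer.Theorems.KatoDescentPotSupersingularReducibleKatoMemberOfValueInputsNodes
import HarnessLib

/-!
# Route `KatoDescentTamePotSupersingular` (rung K8-t′, cell `bsd-potss`): the crux `ReducibleKatoMember`
# (item stmt-BirchSwinnertonDyer-19196, shared with K9) FROM THE VALUE-GUARDED INPUTS AT KATO'S MEMBER —
# thin route-typed restatement of the route-free node theorem
# `Theorems.ReducibleOfValueInputs.katoMemberShaBoundOfReducible_of_memberHullValueInputs`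

Seat `bsd-potss-rkm` generation 10.  The crux M of the route is, by name, the cell's node
`Summit.BirchSwinnertonDyer.Rank1Residual.O6.KatoMemberShaBoundOfReducible` (T-X3K).  The route-free module
`KatoDescentPotSupersingularReducibleKatoMemberOfValueInputsNodes.lean` derives it from THREE named Literature
facts — modularity `ModularForms.exists_isNewformOf`, the VALUE-GUARDED re-type
`Kato2004.exists_memberHullValueInputs` (file `Kato2004/MemberHullValueInputs.lean`: Kato Thm. 12.5 (3), 12.6 +
13.10 (1) + 13.14, §14.14, 14.16 (2) + §14.8, Wuthrich L.14 at `T = V_{ℤ_p}(f)(1)`, for an admissible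
`(c,d,a,A)` with non-zero four-cusp factor; WITHOUT the eight tree-proved clauses `finite_H`, `torsionFree_H`,
`ι_injective`, `finite_coinvariants_H2`, `z_ne_zero`, `isTorsion_quotient`, `lam_constantCoeff_ne_zero`,
`index_ne_zero` of the original `exists_memberHullInputs`) and Gross–Zagier–Kolyvagin
`rank_eq_analyticRank_of_analyticRank_le_one` (a held input of the route).  This file only restates that
theorem with the K8-t′ route decl as its type, in the shapes the planner's resplit glue
`ReducibleKatoMemberOfValueInputs : PublishedInputIwasawaH1Data → PublishedInputNewformKato →
PublishedInputMemberHullValueInputs → PublishedInputRankEqAnalyticRank… → ReducibleKatoMember` consumes: its closer is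
`fun h₁ h₂ h₃ h₄ => tameReducibleKatoMember_of_valueInputs h₁ h₂ h₃ h₄` (every alias unfolds by `rfl`).
CONDITIONAL (audit `proof.conditional`); the item is NOT closed by this file.  HONEST FRAMING: BSD is not
advanced; nothing is booked; the trust base of M becomes {modularity, GZK, the value-guarded transcription}.

References: [Kato2004Asterisque] Thm. 12.5–12.6 (pp. 221–222), Lemma 13.10 (1) (p. 230), 13.14 (p. 234),
§14.14–14.15 (pp. 243–244), Prop. 14.16 (2) (p. 244); [Wuthrich2014] Lemma 14; [Darmon2004] Thm. 3.22;
[DiamondShurman2005] Thm. 8.8.3.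
-/

set_option autoImplicit false
-- sibling precedent (`KatoDescentTamePotSupersingularReducibleKatoMemberOfInputs.lean`): the directory name repeats the summit name
set_option linter.dupNamespace false

noncomputable section

namespace Summit.BirchSwinnertonDyer.BirchSwinnertonDyer.Theorems

open Literature.NumberTheory.EllipticCurves Literature.NumberTheory.EllipticCurves.ModularForms
  Literature.NumberTheory.EllipticCurves.Kato2004

/-- **The K8-t′ crux `ReducibleKatoMember` (item stmt-BirchSwinnertonDyer-19196; type = the route decl
verbatim) from the value-guarded inputs**: `exists_isNewformOf → exists_memberHullValueInputs →
rank_eq_analyticRank_of_analyticRank_le_one → ReducibleKatoMember`, by the route-free node theorem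
`ReducibleOfValueInputs.katoMemberShaBoundOfReducible_of_memberHullValueInputs`.  Conditional on the three
named Literature facts; the item is not closed by this theorem.
[cite: Kato2004Asterisque, Thm. 12.6 (p. 222), §14.14 and Lemma 14.15 (pp. 243–244), Prop. 14.16 (2) (p. 244)]
[cite: Wuthrich2014, Lemma 14 (p. 396)] [cite: Darmon2004, Thm. 3.22] -/
theorem tameReducibleKatoMember_of_memberHullValueInputs (hmod : exists_isNewformOf)
    (hV : Kato2004.exists_memberHullValueInputs) (hGZK : rank_eq_analyticRank_of_analyticRank_le_one) :
    Summit.BirchSwinnertonDyer.BirchSwinnertonDyer.Theses.KatoDescentTamePotSupersingular.ReducibleKatoMember :=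
  ReducibleOfValueInputs.katoMemberShaBoundOfReducible_of_memberHullValueInputs hmod hV hGZK

/-- **Glue-shaped form** (closer of the planner's resplit glue `ReducibleKatoMemberOfValueInputs`, order
`PublishedInputIwasawaH1Data → PublishedInputNewformKato → PublishedInputMemberHullValueInputs →
PublishedInputRankEqAnalyticRank… → ReducibleKatoMember`; the first hypothesis is a theorem and is not used).
Conditional; nothing else assumed. [cite: Kato2004Asterisque, Thm. 12.6 (p. 222), Prop. 14.16 (2) (p. 244)] -/
theorem tameReducibleKatoMember_of_valueInputs (_hne : Kato2004.nonempty_iwasawaH1Data)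
    (hmod : exists_isNewformOf) (hV : Kato2004.exists_memberHullValueInputs)
    (hGZK : rank_eq_analyticRank_of_analyticRank_le_one) :
    Summit.BirchSwinnertonDyer.BirchSwinnertonDyer.Theses.KatoDescentTamePotSupersingular.ReducibleKatoMember :=
  tameReducibleKatoMember_of_memberHullValueInputs hmod hV hGZK

/-- **Conjunction form**. [cite: Kato2004Asterisque, Thm. 12.6 (p. 222), Prop. 14.16 (2) (p. 244)] -/
theorem tameReducibleKatoMember_of_valueInputs_and
    (h : exists_isNewformOf ∧ Kato2004.exists_memberHullValueInputs ∧
      rank_eq_analyticRank_of_analyticRank_le_one) :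
    Summit.BirchSwinnertonDyer.BirchSwinnertonDyer.Theses.KatoDescentTamePotSupersingular.ReducibleKatoMember :=
  tameReducibleKatoMember_of_memberHullValueInputs h.1 h.2.1 h.2.2

end Summit.BirchSwinnertonDyer.BirchSwinnertonDyer.Theorems

end
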